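import Summits.Ventures.HSemireg.WedgeHankelRecurrenceCensusDet

/-!
# Venture HSemireg — SQUARE TOEPLITZ MATRICES OVER A FINITE FIELD: a Toeplitz matrix `(v_{t+i−j})_{i,j ≤ t}` is the Hankel matrix `(v_{i+j})` with its columns reversed (same rank,
# determinant up to the sign of the reversal), so N47's counts transfer verbatim — **of the `s^{2t+1}` Toeplitz matrices of size `t + 1` over a field with `s` elements exactly
# `(s − 1)·s^{2t}` are nonsingular, `s^{2t}` singular, `(s² − 1)·s^{2r−2}` of rank `1 ≤ r ≤ t`** (the nonsingular count is García-Armas–Ghorpade–Ram's, reading only)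

HONEST FRAMING. Part of the Lean index of the computation cell `pub-hsemireg` (seat p10 gen 28, Sunday typer «UNIFORM-IN-n»).
LINEAR ALGEBRA OF HANKEL ∕ TOEPLITZ MATRICES over a field ONLY: no variety, no cohomology theory, no sheaf, no Ext group and no semiregularity map is constructed here; nothing here says
that HC / HC_CM / HC_AV holds; no Literature fact is declared or used.  Custodian versions as in `WedgeHankelSiegelIdeal` (1/3).  READING (not used): García-Armas–Ghorpade–Ram,
J. Combin. Theory Ser. A 118 (2011) (arXiv:1011.1760): the number of nonsingular `n × n` Toeplitz matrices over `F_q` is `q^{2n−2}(q − 1)`; Daykin 1960.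

WHAT IS KEYED.  N47 (`WedgeHankelRecurrenceCensusDet`, № 330): `hankelSq`, `ncard_setOf_det_hankelSq_ne_zero`, `ncard_setOf_det_hankelSq_eq_zero`, `ncard_setOf_rank_hankelSq_eq`,
`ncard_setOf_rank_hankelSq_le`; N44 (№ 326) `seqOf`.  Mathlib: `Fin.revPerm`, `Matrix.rank_submatrix`, `Matrix.det_permute'`, `Equiv.Perm.sign`.
THIS FILE (namespace `Summit.Ventures.HSemireg.Wedge.HankelOuter` continued; CHAINED on N47; 1 definition `toeplitzSq`):
* §568 `toeplitzSq K t q` = `(q_{t+i−j})_{i,j ≤ t}`; **`toeplitzSq_eq_submatrix`** (= `hankelSq` with columns reversed), **`rank_toeplitzSq`**, **`det_toeplitzSq`** (`= sign(rev) · det hankelSq`),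
  `det_toeplitzSq_ne_zero_iff`.
* §569 THE COUNTS over `v : Fin (2t+1) → K` (`[Finite K]`, `s = Nat.card K`): **`ncard_setOf_det_toeplitzSq_ne_zero`** (`(s − 1)·s^{2t}`), **`ncard_setOf_det_toeplitzSq_eq_zero`** (`s^{2t}`),
  `ncard_setOf_rank_toeplitzSq_eq` (`(s² − 1)·s^{2r−2}`, `1 ≤ r ≤ t`), `ncard_setOf_rank_toeplitzSq_le` (`s^{2r}`).
Nothing Ext-side.  New names only.
-/

open Module Polynomial
open scoped Matrix Polynomial

namespace Summit.Ventures.HSemireg.Wedge.HankelOuter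

open Summit.Ventures.HSemireg.Wedge Summit.Ventures.HSemireg.Wedge.Hankel

variable (K : Type*) [Field K]

/-! ## §568. Toeplitz = Hankel with the columns reversed -/

/-- THE SQUARE TOEPLITZ MATRIX `(q_{t+i−j})_{i, j ≤ t}` of a coefficient sequence (constant along diagonals; first row `q_t, …, q_0`, first column `q_t, …, q_{2t}`). [definition of this file] -/
def toeplitzSq (t : ℕ) (q : ℕ → K) : Matrix (Fin (t + 1)) (Fin (t + 1)) K := Matrix.of fun i j => q (t + (i : ℕ) - (j : ℕ))

omit [Field K] in
/-- **`toeplitzSq t q` is `hankelSq t q` with its columns reversed.** -/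
theorem toeplitzSq_eq_submatrix (t : ℕ) (q : ℕ → K) : toeplitzSq K t q = (hankelSq K t q).submatrix id Fin.revPerm := by
  ext i j
  simp only [toeplitzSq, hankelSq, Matrix.submatrix_apply, Matrix.of_apply, id, Fin.revPerm_apply, Fin.val_rev]
  congr 1
  have := j.2
  omega

/-- **same rank as the Hankel matrix** (= the middle rank `R^{2t}(q)` by N47). -/
theorem rank_toeplitzSq (t : ℕ) (q : ℕ → K) : (toeplitzSq K t q).rank = (hankelSq K t q).rank := by
  rw [toeplitzSq_eq_submatrix, show (id : Fin (t + 1) → Fin (t + 1)) = (Equiv.refl (Fin (t + 1)) : Fin (t + 1) → Fin (t + 1)) from rfl, Matrix.rank_submatrix]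

/-- **determinant up to the sign of the reversal.** -/
theorem det_toeplitzSq (t : ℕ) (q : ℕ → K) : (toeplitzSq K t q).det = Equiv.Perm.sign (Fin.revPerm : Equiv.Perm (Fin (t + 1))) * (hankelSq K t q).det := by
  rw [toeplitzSq_eq_submatrix, Matrix.det_permute']

/-- `det toeplitzSq ≠ 0 ↔ det hankelSq ≠ 0`. -/
theorem det_toeplitzSq_ne_zero_iff (t : ℕ) (q : ℕ → K) : (toeplitzSq K t q).det ≠ 0 ↔ (hankelSq K t q).det ≠ 0 := by
  rw [det_toeplitzSq, mul_ne_zero_iff, and_iff_right]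
  rcases Int.units_eq_one_or (Equiv.Perm.sign (Fin.revPerm : Equiv.Perm (Fin (t + 1)))) with h | h <;> rw [h] <;> simp

/-! ## §569. The counts -/

/-- **NONSINGULAR SQUARE TOEPLITZ MATRICES: `(s − 1)·s^{2t}` of the `s^{2t+1}` matrices `(v_{t+i−j})_{i,j ≤ t}` over a finite field with `s` elements.** -/
theorem ncard_setOf_det_toeplitzSq_ne_zero [Finite K] (t : ℕ) :
    {v : Fin (2 * t + 1) → K | (toeplitzSq K t (seqOf K v)).det ≠ 0}.ncard = (Nat.card K - 1) * Nat.card K ^ (2 * t) := by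
  rw [← ncard_setOf_det_hankelSq_ne_zero K t]
  congr 1
  ext v
  rw [Set.mem_setOf_eq, Set.mem_setOf_eq, det_toeplitzSq_ne_zero_iff]

/-- **… and `s^{2t}` are SINGULAR** (probability exactly `1/s`). -/
theorem ncard_setOf_det_toeplitzSq_eq_zero [Finite K] (t : ℕ) : {v : Fin (2 * t + 1) → K | (toeplitzSq K t (seqOf K v)).det = 0}.ncard = Nat.card K ^ (2 * t) := by
  rw [← ncard_setOf_det_hankelSq_eq_zero K t]
  congr 1
  ext v
  rw [Set.mem_setOf_eq, Set.mem_setOf_eq, ← not_iff_not]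
  exact det_toeplitzSq_ne_zero_iff K t (seqOf K v)

/-- by rank: `(s² − 1)·s^{2r−2}` Toeplitz matrices of rank `1 ≤ r ≤ t`. -/
theorem ncard_setOf_rank_toeplitzSq_eq [Finite K] {t r : ℕ} (hr : 1 ≤ r) (hrt : r ≤ t) :
    {v : Fin (2 * t + 1) → K | (toeplitzSq K t (seqOf K v)).rank = r}.ncard = (Nat.card K ^ 2 - 1) * Nat.card K ^ (2 * r - 2) := by
  rw [← ncard_setOf_rank_hankelSq_eq K hr hrt]
  congr 1
  ext v
  rw [Set.mem_setOf_eq, Set.mem_setOf_eq, rank_toeplitzSq]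

/-- cumulatively: `s^{2r}` Toeplitz matrices of rank `≤ r ≤ t`. -/
theorem ncard_setOf_rank_toeplitzSq_le [Finite K] {t r : ℕ} (hrt : r ≤ t) : {v : Fin (2 * t + 1) → K | (toeplitzSq K t (seqOf K v)).rank ≤ r}.ncard = Nat.card K ^ (2 * r) := by
  rw [← ncard_setOf_rank_hankelSq_le K hrt]
  congr 1
  ext v
  rw [Set.mem_setOf_eq, Set.mem_setOf_eq, rank_toeplitzSq]

end Summit.Ventures.HSemireg.Wedge.HankelOuter
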